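import Summits.BirchSwinnertonDyer.BirchSwinnertonDyer.Theorems.PrintCf2RamifiedOffTYZGeneratorDepth
import Summits.BirchSwinnertonDyer.BirchSwinnertonDyer.Theorems.PrintCf2RamifiedOffTYZLevelTwoDepth
import HarnessLib

/-!
# Route `PrintCf2`, crux stmt-BirchSwinnertonDyer-20509 `RamifiedOffTYZOfFacts` — GENERATOR DEPTH, part 3: consequences for C⁺ on the block-free
# family — THE LOWER HALF AT `ρ(n) = 1` WITH NO SELMER HYPOTHESIS, and C⁺ there ⟺ `[P(n)] ≠ 0`
# (cell `bsd-print-cf2`, LEAD of 20509 g18, line `offtyz-v7`, lineage cycle 19; fact-free, Theses-free, no `def`)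

HONEST FRAMING (crux 20509 = `𝔅_ram → WAllCornerFTwoRamifiedOffTYZProved`, DECIDING, OPEN AS A CLASS; C⁺ = `stub_offTYZ_levelTwoScriptLExact`
= item stmt-BirchSwinnertonDyer-23431: on the jump-one rank-one class `2 ∥ 𝓛(n)`; OPEN, NO PRINT, equivalent to `BSD(E_n, 2)` there).
Bookkeeping on Tian–Yuan–Zhang's Thm. 3.5 main clause, integrality and Lemma 3.18 taken as HYPOTHESES on the displayed data (`D.Printed` on
`D : GenusPointData n`, arXiv:1411.4728 §3 AS PRINTED), the compositum display `D.CMPointCompositumPrinted` (g16; on the block-free family it makes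
`Gal(ℍ′_n/ℚ)` commutative), GZK by name (`hGZK`), the W2 descent kernel and parts 1–2 of this cycle.  Nothing is asserted; no named fact is
introduced here (the `OfFacts` forms take `tyz_cmPointCompositumData ∧ GZK` as an explicit hypothesis, as `…LowerHalfVisibleSeven` does).

* §4 `two_dvd_scriptL_of_rhoIndex_eq_two_of_displays` — **square-free `n ≡ 7 (mod 8)` with no divisor `≡ 5 (mod 8)` (block-free),
  `ord_{s=1} L(E_n, s) = 1`, GZK, displays, and `[E_n(ℚ) : φ_n(A_n(ℚ)) + E_n[2]] = 2` (`ρ(n) = 1`) ⟹ `2 ∣ L` for every `L` with `𝓛(n)² = L²`** —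
  the LOWER HALF of C⁺ at `ρ = 1` with NO `#Sel₂` hypothesis (part 2: the half `Q₁` is visible; g11's `…LevelTwoHalves.two_dvd_scriptL_of_half_not_
  twoDivisible`).  The lineage's `ρ = 1` lower half (`…HalfMover`, `…LowerHalfRhoOneOfFacts`, g11) needs `#Sel₂(E_n) = 2^{2+s}`, `s ≥ 2` and holds for
  every odd `n`; this one needs no Selmer count and holds for block-free `n` — e.g. on TYZ's own `𝓛`-odd families it says `ρ(n) = 0` there
  (consistent with `…SquareMoverRho`: `𝓛` odd ⟹ (ρ = 1 ⟺ a square-mover exists), and squares are trivial in an abelian `Gal(ℍ′_n/ℚ)`).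
  `…_of_facts'` / `…_of_facts`: the same granted `tyz_cmPointCompositumData ∧ GZK` (by-name closable aside text for the planner).
* `levelTwo_iff_genusPoint_not_twoDivisible_of_rhoIndex_eq_two` — same hypotheses: **the conclusion of C⁺ at `n` ⟺ `P(n) ∉ 2A(ℍ′_n) + tors`**
  (`…LevelTwoDepth`: C⁺ ⟺ «depth P(n) = depth Q₁», and depth `Q₁ = 0`).

What this buys the line (LEAD census, crux 20509): on the block-free family the three strata of the jump-one class now read — `ρ = 1`: lower
half PROVED (this file), C⁺ ⟺ `[P(n)] ≠ 0`; `ρ = 0` visible (`[α_n] ≠ 0`): lower half PROVED (g16), C⁺ ⟺ `[P(n)] ≠ 0` (g3); `ρ = 0` invisible: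
`depth α_n = 1` exactly (part 2), lower half ⟺ `[P(n)] = 0`, C⁺ ⟺ `depth P(n) = 1`.  Every remaining statement is about TYZ's point `P(n)` alone —
the UPPER half stays the one undisplayed bit (Kolyvagin exactness at `2`).  Beyond-print theorem: YES (the `ρ = 1` lower half on the block-free
family with no Selmer hypothesis, conditional on the displays + GZK).  BSD is not proved by any of this; C⁺ / crux 20509 stay OPEN; no class
is closed by this file.

References: [cite: TianYuanZhang2017, §1 (arXiv:1411.4728 chunk p0002 L101–L110: `ρ(n)`, `φ_n`), §3.1 (p0011 L27–L36: `A(K_n)⁻`, `α_n`;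
p0011 L58–L66: `ℍ′_n := L_n(i)·∏ H′_{d₀}`), Prop. 3.2 (3) (p0010 L112), Thm. 3.5 (p0011 L94–L100), Lemma 3.16 (p0017 L98–L113),
Lemma 3.18 (p0017 L152–L153)]; [cite: SilvermanAEC2009, Prop. X.4.9, X.5 Cor. 5.4]; [cite: Darmon2004, Thm. 3.22] (GZK, binder `hGZK`);
[cite: Lang2002, VI §1 Thm. 1.2, Cor. 1.4]; tree: `…LevelTwoRhoValve` (g3), `…LevelTwoHalves` / `…LevelTwoGenusQuotient` (g11),
`…LevelTwoDepth` (g3), `…VisibleGenerator` / `…LowerHalfVisibleSeven` / `TianYuanZhang2017/CMPointCompositumDisplays` (g16),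
`TianYuanZhang2017/GenusDescent{Defs,Twist,EnSide}` (W2 kernel), LEAD memo `Cruxes/RamifiedOffTYZOfFacts/Lines/offtyz_v7_GeneratorDepth.md`.
-/

noncomputable section

open scoped Classical

open WeierstrassCurve WeierstrassCurve.Affine WeierstrassCurve.Affine.Point
  Literature.NumberTheory.EllipticCurves Literature.NumberTheory.EllipticCurves.Rank1Residual
  Summit.BirchSwinnertonDyer.Rank1Residual
  Literature.NumberTheory.EllipticCurves.TianYuanZhang2017
  Literature.NumberTheory.EllipticCurves.TianYuanZhang2017.W2
  Summit.BirchSwinnertonDyer.PrintCf2.GaloisMotion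
  Summit.BirchSwinnertonDyer.Rank1Residual.P2.ThetaDescent
  Summit.BirchSwinnertonDyer.PrintCf2.LowerHalfVisible

set_option autoImplicit false

namespace Summit.BirchSwinnertonDyer.PrintCf2.GeneratorDepth

variable {n : ℕ}

/-! ## §4 Consequences for C⁺ = `stub_offTYZ_levelTwoScriptLExact` on the block-free family: the lower half at `ρ(n) = 1` with NO
Selmer hypothesis, and C⁺ there ⟺ `[P(n)] ≠ 0` -/

/-- For odd `n`, no divisor is `≡ 6 (mod 8)`; with «no divisor `≡ 5 (mod 8)`» the family has NO block. [folklore] -/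
private theorem noBlock_of_odd' (hodd : Odd n) (hnb : ∀ d ∈ n.divisors, d % 8 ≠ 5) :
    ∀ d ∈ n.divisors, d % 8 ≠ 5 ∧ d % 8 ≠ 6 := by
  intro d hd
  refine ⟨hnb d hd, fun h6 => ?_⟩
  obtain ⟨k, hk⟩ := hodd.of_dvd_nat (Nat.dvd_of_mem_divisors hd)
  omega

/-- **THE LOWER HALF OF C⁺ AT `ρ(n) = 1` ON THE BLOCK-FREE FAMILY — NO SELMER HYPOTHESIS (display form).**  Square-free `n ≡ 7 (mod 8)`
with no divisor `≡ 5 (mod 8)`; `ord_{s=1} L(E_n, s) = 1`; GZK; data `D` with the displays `Printed` (Thm. 3.5, integrality, Lemma 3.18) and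
`CMPointCompositumPrinted` (the compositum sentence: `Gal(ℍ′_n/ℚ)` commutative); `[E_n(ℚ) : φ_n(A_n(ℚ)) + E_n[2]] = 2`.  Then
**`2 ∣ L` for every `L` with `𝓛(n)² = L²`**.  (The lineage's `ρ = 1` lower half, `…LowerHalfRhoOneOfFacts`, needs `#Sel₂(E_n) = 2^{2+s}` with
`s ≥ 2` and works for every odd `n`; here no Selmer count, block-free `n`.)
[cite: TianYuanZhang2017, §1 (p0002 L101–L110), §3.1 (p0011 L27–L36, L58–L66), Prop. 3.2 (3) (p0010 L112), Thm. 3.5 (p0011 L94–L100), Lemma 3.18 (p0017 L152–L153)]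
[cite: SilvermanAEC2009, Prop. X.4.9] [cite: Darmon2004, Thm. 3.22] [cite: Lang2002, VI §1 Thm. 1.2, Cor. 1.4] -/
theorem two_dvd_scriptL_of_rhoIndex_eq_two_of_displays (hGZK : rank_eq_analyticRank_of_analyticRank_le_one) (hsq : Squarefree n)
    (h7 : n % 8 = 7) (hnb : ∀ d ∈ n.divisors, d % 8 ≠ 5)
    (hr : haveI := isElliptic_congruentNumberCurve hsq.ne_zero; (congruentNumberCurve n).analyticRank = 1)
    (D : GenusPointData n) (hPr : D.Printed) (hC : D.CMPointCompositumPrinted) (hρ : (rhoSubgroup n).index = 2)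
    {L : ℤ} (hL : IsScriptL n L) : (2 : ℤ) ∣ L := by
  haveI := isElliptic_congruentNumberCurve hsq.ne_zero
  have hn : n ∈ n.divisors := Nat.mem_divisors_self n hsq.ne_zero
  have hodd : Odd n := Nat.odd_iff.mpr (by omega)
  have hn1 : 1 < n := by omega
  have h35 : D.thm35Main := hPr.2.2.2.2.1
  have hLs : D.scriptLSpec := hPr.1
  have h318 : D.lemma318 := hPr.2.2.2.2.2.2.2.2.1
  obtain ⟨z, Φ, ΓH, ΓH', σ, θ, c, ρ₂, ρ₄, -, -, hcomp⟩ := hC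
  have hcomm : ∀ g h : D.H ≃ₐ[ℚ] D.H, g * h = h * g := fun g h => hcomp.commute_of_noBlock (noBlock_of_odd' hodd hnb) g h
  have hrank : (congruentNumberCurve n).mordellWeilRank = 1 := (hGZK _ hr.le).1.trans hr
  obtain ⟨R, hR⟩ := stub_S0 (n := n) hrank.le
  obtain ⟨Q₁, hQ₁⟩ := twist_halving hsq hn D R
  have hQ2 := half_not_twoDivisible_of_rhoIndex_eq_two hsq hodd hn1 D h318 hcomm hrank hρ hR hQ₁
  exact LevelTwoHalves.two_dvd_scriptL_of_half_not_twoDivisible hGZK hsq hr D h35 hLs hn1 hR hQ₁ hQ2 L hL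

/-- **The same, GRANTED THE NAMED FACTS** `tyz_cmPointCompositumData` (TYZ §3 displays incl. the compositum sentence) and GZK.
[cite: TianYuanZhang2017, §1, §3.1 (p0011 L58–L66), Thm. 3.5, Lemma 3.18] [cite: Darmon2004, Thm. 3.22] -/
theorem two_dvd_scriptL_of_rhoIndex_eq_two_of_facts' (hF : tyz_cmPointCompositumData)
    (hGZK : rank_eq_analyticRank_of_analyticRank_le_one) (hsq : Squarefree n) (h7 : n % 8 = 7)
    (hnb : ∀ d ∈ n.divisors, d % 8 ≠ 5)
    (hr : haveI := isElliptic_congruentNumberCurve hsq.ne_zero; (congruentNumberCurve n).analyticRank = 1)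
    (hρ : (rhoSubgroup n).index = 2) : ∀ L : ℤ, IsScriptL n L → (2 : ℤ) ∣ L := by
  obtain ⟨D, hPr, hC⟩ := hF n hsq (Or.inr (Or.inr h7))
  exact fun L hL => two_dvd_scriptL_of_rhoIndex_eq_two_of_displays hGZK hsq h7 hnb hr D hPr hC hρ hL

/-- **`OfFacts` shape for the planner** (a by-name closable aside text: the lower half of C⁺ on `{ρ(n) = 1}` of the block-free family
`n ≡ 7 (mod 8)`, no divisor `≡ 5 (mod 8)`; no `thm11`, no `#Sel₂` hypothesis).
[cite: TianYuanZhang2017, §1, §3.1 (p0011 L58–L66), Thm. 3.5, Lemma 3.18] [cite: Darmon2004, Thm. 3.22] -/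
theorem two_dvd_scriptL_of_rhoIndex_eq_two_of_facts :
    (tyz_cmPointCompositumData ∧ rank_eq_analyticRank_of_analyticRank_le_one) →
      ∀ n : ℕ, (hsq : Squarefree n) → n % 8 = 7 → (∀ d ∈ n.divisors, d % 8 ≠ 5) →
        (haveI := isElliptic_congruentNumberCurve hsq.ne_zero; (congruentNumberCurve n).analyticRank = 1) →
        (rhoSubgroup n).index = 2 → ∀ L : ℤ, IsScriptL n L → (2 : ℤ) ∣ L :=
  fun hFG _ hsq h7 hnb hr hρ => two_dvd_scriptL_of_rhoIndex_eq_two_of_facts' hFG.1 hFG.2 hsq h7 hnb hr hρ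

/-- **C⁺ AT `ρ(n) = 1` ON THE BLOCK-FREE FAMILY ⟺ `[P(n)] ≠ 0`** (display form; same hypotheses): the conclusion of
`stub_offTYZ_levelTwoScriptLExact` at `n` (`2 ∣ L ∧ 4 ∤ L` for every `L` with `𝓛(n)² = L²`) holds iff TYZ's point `P(n)` is NOT `2`-divisible in
`A(ℍ′_n)` modulo torsion — the visible half `Q₁` has depth `0`, so C⁺ (= «depth P(n) = depth Q₁», `…LevelTwoDepth`) is the single bit `[P(n)]`.
[cite: TianYuanZhang2017, §1 (p0002 L101–L110), §3.1 (p0011 L27–L36, L58–L66), Thm. 3.5 (p0011 L94–L100), Lemma 3.18 (p0017 L152–L153)]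
[cite: SilvermanAEC2009, Prop. X.4.9] [cite: Darmon2004, Thm. 3.22] -/
theorem levelTwo_iff_genusPoint_not_twoDivisible_of_rhoIndex_eq_two (hGZK : rank_eq_analyticRank_of_analyticRank_le_one)
    (hsq : Squarefree n) (h7 : n % 8 = 7) (hnb : ∀ d ∈ n.divisors, d % 8 ≠ 5)
    (hr : haveI := isElliptic_congruentNumberCurve hsq.ne_zero; (congruentNumberCurve n).analyticRank = 1)
    (D : GenusPointData n) (hPr : D.Printed) (hC : D.CMPointCompositumPrinted) (hρ : (rhoSubgroup n).index = 2) :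
    (∀ L : ℤ, IsScriptL n L → (2 : ℤ) ∣ L ∧ ¬ (4 : ℤ) ∣ L) ↔
      ¬ ∃ y : APoint D.H, IsOfFinAddOrder (D.P n - (2 : ℤ) • y) := by
  haveI := isElliptic_congruentNumberCurve hsq.ne_zero
  have hn : n ∈ n.divisors := Nat.mem_divisors_self n hsq.ne_zero
  have hodd : Odd n := Nat.odd_iff.mpr (by omega)
  have hn1 : 1 < n := by omega
  have h8 : n % 8 = 5 ∨ n % 8 = 6 ∨ n % 8 = 7 := Or.inr (Or.inr h7)
  have h35 : D.thm35Main := hPr.2.2.2.2.1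
  have hLs : D.scriptLSpec := hPr.1
  have h318 : D.lemma318 := hPr.2.2.2.2.2.2.2.2.1
  obtain ⟨z, Φ, ΓH, ΓH', σ, θ, c, ρ₂, ρ₄, -, -, hcomp⟩ := hC
  have hcomm : ∀ g h : D.H ≃ₐ[ℚ] D.H, g * h = h * g := fun g h => hcomp.commute_of_noBlock (noBlock_of_odd' hodd hnb) g h
  have hrank : (congruentNumberCurve n).mordellWeilRank = 1 := (hGZK _ hr.le).1.trans hr
  obtain ⟨R, hR⟩ := stub_S0 (n := n) hrank.le
  obtain ⟨Q₁, hQ₁⟩ := twist_halving hsq hn D R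
  have hQ2 := half_not_twoDivisible_of_rhoIndex_eq_two hsq hodd hn1 D h318 hcomm hrank hρ hR hQ₁
  -- `Q₁ ∉ 2^k A + tors` for every `k ≥ 1`
  have hQk : ∀ k : ℕ, 1 ≤ k → ¬ ∃ y : APoint D.H, IsOfFinAddOrder (Q₁ - ((2 : ℤ) ^ k) • y) := by
    rintro k hk ⟨y, hy⟩
    obtain ⟨j, rfl⟩ : ∃ j, k = j + 1 := ⟨k - 1, by omega⟩
    exact hQ2 ⟨((2 : ℤ) ^ j) • y, by rwa [smul_smul, ← pow_succ']⟩
  constructor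
  · intro hC2 hP2
    have h1 := (LevelTwoHalfGenerator.twoPowDivisible_iff_of_levelTwo hGZK hsq h8 hr D h35 hLs hR hQ₁ hC2 1).mp
      (by rw [pow_one]; exact hP2)
    exact hQk 1 le_rfl h1
  · intro hP2
    refine LevelTwoDepth.levelTwo_of_twoPowDivisible_iff_half hGZK hsq h8 hr D h35 hLs hR hQ₁ fun k => ?_
    rcases Nat.eq_zero_or_pos k with rfl | hk
    · exact ⟨fun _ => ⟨Q₁, by rw [pow_zero, one_smul, sub_self]; exact IsOfFinAddOrder.zero⟩,
        fun _ => ⟨D.P n, by rw [pow_zero, one_smul, sub_self]; exact IsOfFinAddOrder.zero⟩⟩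
    · constructor
      · rintro ⟨y, hy⟩
        obtain ⟨j, rfl⟩ : ∃ j, k = j + 1 := ⟨k - 1, by omega⟩
        exact absurd ⟨((2 : ℤ) ^ j) • y, by rwa [smul_smul, ← pow_succ']⟩ hP2
      · intro h
        exact absurd h (hQk k hk)

end Summit.BirchSwinnertonDyer.PrintCf2.GeneratorDepth

end
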